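import Literature.NumberTheory.ConnesConsani2021.EpsSlopeFrobeniusToolkit
import Mathlib.MeasureTheory.Integral.DominatedConvergence
import Mathlib.Analysis.Normed.Ring.InfiniteSum
import HarnessLib

/-!
# Connes–Consani 2021, Lemma 5.4 numerics: the integrals `∫₀¹ u_b`, `∫₀¹ u_b²` of the principal
# Frobenius solution as series (what the (E-b) kernel certificate sums), PROVED

RH-FREE corpus literature (label, line 1): elementary series bookkeeping for
`u_b(x) = Σ_k a_k(b)(1 − x)^k` (`frobSol 1 b`, `ProlateFrobenius.lean`); companion of gm-t16's
`EpsSlopeFrobeniusToolkit.lean` (cell rh-crit, (E-b) Tier 2, cc-lead R80 (1) division: these are the two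
"series links" left to this seat).  bears_on (cell rh-crit, corpus C1): apex input (B) — route
«ConnesConsaniSemilocal» item K2 `DensitySlope` (stmt 19308), the (E-b) conjunct of
`CC2021_section6_enclosures` (the kernel certificate for `ε′(1⁺) ≈ 22.9965`, CC2021 Lemma 5.4).
Nothing in this file mentions `ζ` or RH; nothing here bears on the truth of RH.

Sources: A. Connes, C. Consani, *Weil positivity and trace formula, the archimedean place*, Selecta
Math. (N.S.) 27 (2021) 77 = arXiv:2006.13771 [cite: ConnesConsani2021, Lemma 5.4 §5 pp. 32–33
(ε′(1⁺) = Σ t(n) ≃ 22.9965)]; the Frobenius construction [Coddington–Levinson 1955, Ch. 4 §8].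

## Content (all PROVED, 0 definitions, 0 facts)

* `integral_frobSol_one : ∫₀¹ u_b = Σ_k a_k/(k+1)` (termwise integration: `|a_k(1−x)^k| ≤ |a_k|`
  summable, `integral_tsum_of_summable_integral_norm`);
* `abs_integral_frobSol_one_sub_le : |∫₀¹ u_b − Σ_{k<N} a_k/(k+1)| ≤ Σ_k |a_{k+N}|`;
* `integral_frobSol_sq_one : ∫₀¹ u_b² = Σ_{(i,j)} a_i a_j/(i+j+1)` (Cauchy product of the absolutely
  convergent series, termwise integration over `ℕ × ℕ`);
* `abs_integral_frobSol_sq_one_sub_le : |∫₀¹ u_b² − Σ_{i,j<N} a_i a_j/(i+j+1)| ≤ 2Aτ + τ²`,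
  `A = Σ_{k<N}|a_k|`, `τ = Σ_k |a_{k+N}|` — exactly the widening the kernel layer applies to `∫₀¹u²`.
-/

noncomputable section

open Real Set Filter Topology MeasureTheory intervalIntegral Finset

namespace Literature.NumberTheory.ConnesConsani2021.SlopeCert

open Literature.NumberTheory.LFunctions

/-- `|Σ f| ≤ Σ |f|` for an absolutely summable real family. [folklore] -/
private theorem abs_tsum_le_tsum_abs {ι : Type*} {f : ι → ℝ} (hf : Summable fun i ↦ |f i|) :
    |∑' i, f i| ≤ ∑' i, |f i| := by
  have h := norm_tsum_le_tsum_norm (f := f) (by simpa only [Real.norm_eq_abs] using hf)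
  simpa only [Real.norm_eq_abs] using h

/-- `Σ_k |a_k| = Σ_{k<N} |a_k| + Σ_k |a_{k+N}|`. [cite: CoddingtonLevinson1955, Ch. 4 §8] -/
theorem tsum_abs_frobCoeff_split (χ : ℝ) (N : ℕ) :
    ∑' k : ℕ, |frobCoeff 1 χ k| =
      ∑ k ∈ range N, |frobCoeff 1 χ k| + ∑' k : ℕ, |frobCoeff 1 χ (k + N)| :=
  ((summable_abs_frobCoeff_one χ).sum_add_tsum_nat_add N).symm

/-- `∫₀¹ (1 − x)^k dx = 1/(k+1)`. [folklore] -/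
private theorem integral_one_sub_pow (k : ℕ) : ∫ x in (0 : ℝ)..1, (1 - x) ^ k = 1 / ((k : ℝ) + 1) := by
  rw [intervalIntegral.integral_comp_sub_left (fun x : ℝ ↦ x ^ k) (1 : ℝ), sub_self, sub_zero,
    integral_pow]
  simp

/-- `(1 − x)^k ≥ 0` on `[0,1]`. [folklore] -/
private theorem one_sub_pow_nonneg {x : ℝ} (hx : x ∈ uIcc (0 : ℝ) 1) (k : ℕ) : 0 ≤ (1 - x) ^ k := by
  rw [Set.uIcc_of_le zero_le_one] at hx
  exact pow_nonneg (by linarith [hx.2]) k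

/-- `|(1 − x)^k| ≤ 1` on `[0,1]`. [folklore] -/
private theorem abs_one_sub_pow_le {x : ℝ} (hx : x ∈ uIcc (0 : ℝ) 1) (k : ℕ) : |(1 - x) ^ k| ≤ 1 := by
  rw [Set.uIcc_of_le zero_le_one] at hx
  rw [abs_pow]
  exact pow_le_one₀ (abs_nonneg _) (by rw [abs_le]; constructor <;> linarith [hx.1, hx.2])

/-- The `k`-th term `a_k (1−x)^k` has `∫_{(0,1]} ‖·‖ = |a_k|/(k+1)`. [folklore] -/
private theorem integral_norm_term (χ : ℝ) (k : ℕ) :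
    ∫ x in Ioc (0 : ℝ) 1, ‖frobCoeff 1 χ k * (1 - x) ^ k‖ = |frobCoeff 1 χ k| / ((k : ℝ) + 1) := by
  rw [← intervalIntegral.integral_of_le zero_le_one]
  have : ∀ x ∈ uIcc (0 : ℝ) 1, ‖frobCoeff 1 χ k * (1 - x) ^ k‖ = |frobCoeff 1 χ k| * (1 - x) ^ k := by
    intro x hx
    rw [Real.norm_eq_abs, abs_mul, abs_of_nonneg (one_sub_pow_nonneg hx k)]
  rw [intervalIntegral.integral_congr this, intervalIntegral.integral_const_mul, integral_one_sub_pow]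
  ring

/-- **`∫₀¹ u_χ = Σ_k a_k/(k+1)`** (termwise integration of the Frobenius series on `[0,1]`, where
`|a_k (1−x)^k| ≤ |a_k|` is summable). [cite: CoddingtonLevinson1955, Ch. 4 §8] -/
theorem integral_frobSol_one (χ : ℝ) :
    ∫ x in (0 : ℝ)..1, frobSol 1 χ x = ∑' k : ℕ, frobCoeff 1 χ k / ((k : ℝ) + 1) := by
  rw [intervalIntegral.integral_of_le zero_le_one]
  have hF_int : ∀ k : ℕ, Integrable (fun x : ℝ ↦ frobCoeff 1 χ k * (1 - x) ^ k) (volume.restrict (Ioc 0 1)) :=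
    fun k ↦ (Continuous.integrableOn_Icc (by fun_prop)).mono_set Ioc_subset_Icc_self
  have hF_sum : Summable fun k : ℕ ↦ ∫ x in Ioc (0 : ℝ) 1, ‖frobCoeff 1 χ k * (1 - x) ^ k‖ := by
    simp_rw [integral_norm_term]
    refine (summable_abs_frobCoeff_one χ).of_nonneg_of_le (fun k ↦ by positivity) fun k ↦ ?_
    exact div_le_self (abs_nonneg _) (by linarith [(Nat.cast_nonneg k : (0 : ℝ) ≤ k)])
  have h := integral_tsum_of_summable_integral_norm hF_int hF_sum
  have hterm : ∀ k : ℕ, ∫ x in Ioc (0 : ℝ) 1, frobCoeff 1 χ k * (1 - x) ^ k = frobCoeff 1 χ k / ((k : ℝ) + 1) := by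
    intro k
    rw [← intervalIntegral.integral_of_le zero_le_one, intervalIntegral.integral_const_mul,
      integral_one_sub_pow]
    ring
  simp_rw [hterm] at h
  rw [h]
  rfl

/-- **Tail control for `∫₀¹ u_χ`**: `|∫₀¹ u_χ − Σ_{k<N} a_k/(k+1)| ≤ Σ_k |a_{k+N}|`.
[cite: ConnesConsani2021, Lemma 5.4 §5 p. 33 (the truncated sums behind ε′(1⁺) ≃ 22.9965); CoddingtonLevinson1955, Ch. 4 §8] -/
theorem abs_integral_frobSol_one_sub_le (χ : ℝ) (N : ℕ) :
    |(∫ x in (0 : ℝ)..1, frobSol 1 χ x) - ∑ k ∈ range N, frobCoeff 1 χ k / ((k : ℝ) + 1)|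
      ≤ ∑' k : ℕ, |frobCoeff 1 χ (k + N)| := by
  have hk1 : ∀ k : ℕ, (1 : ℝ) ≤ (k : ℝ) + 1 := fun k ↦ by linarith [(Nat.cast_nonneg k : (0 : ℝ) ≤ k)]
  have hterm : ∀ k : ℕ, |frobCoeff 1 χ k / ((k : ℝ) + 1)| ≤ |frobCoeff 1 χ k| := by
    intro k
    rw [abs_div, abs_of_pos (by positivity : (0 : ℝ) < (k : ℝ) + 1)]
    exact div_le_self (abs_nonneg _) (hk1 k)
  have hs : Summable fun k : ℕ ↦ frobCoeff 1 χ k / ((k : ℝ) + 1) :=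
    Summable.of_norm_bounded (summable_abs_frobCoeff_one χ) fun k ↦ by rw [Real.norm_eq_abs]; exact hterm k
  rw [integral_frobSol_one, ← hs.sum_add_tsum_nat_add N, add_sub_cancel_left]
  have hs' : Summable fun k : ℕ ↦ |frobCoeff 1 χ (k + N)| :=
    (summable_nat_add_iff N).2 (summable_abs_frobCoeff_one χ)
  have hsN : Summable fun k : ℕ ↦ |frobCoeff 1 χ (k + N) / (((k + N : ℕ) : ℝ) + 1)| :=
    hs'.of_nonneg_of_le (fun k ↦ abs_nonneg _) fun k ↦ hterm (k + N)
  exact (abs_tsum_le_tsum_abs hsN).trans (Summable.tsum_le_tsum (fun k ↦ hterm (k + N)) hsN hs')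

/-- **`∫₀¹ u_χ² = Σ_{i,j} a_i a_j/(i+j+1)`** (Cauchy product of the absolutely convergent Frobenius
series, termwise integration). [cite: CoddingtonLevinson1955, Ch. 4 §8] -/
theorem integral_frobSol_sq_one (χ : ℝ) :
    ∫ x in (0 : ℝ)..1, frobSol 1 χ x ^ 2 =
      ∑' p : ℕ × ℕ, frobCoeff 1 χ p.1 * frobCoeff 1 χ p.2 / ((p.1 : ℝ) + p.2 + 1) := by
  set a : ℕ → ℝ := fun k ↦ frobCoeff 1 χ k with ha
  have hsa : Summable fun k ↦ |a k| := summable_abs_frobCoeff_one χ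
  -- pointwise Cauchy product on [0,1]
  have hpt : ∀ x ∈ Ioc (0 : ℝ) 1, frobSol 1 χ x ^ 2 =
      ∑' p : ℕ × ℕ, a p.1 * a p.2 * (1 - x) ^ (p.1 + p.2) := by
    intro x hx
    have hx' : x ∈ uIcc (0 : ℝ) 1 := by rw [Set.uIcc_of_le zero_le_one]; exact ⟨hx.1.le, hx.2⟩
    have hsx : Summable fun k ↦ ‖a k * (1 - x) ^ k‖ := by
      refine hsa.of_nonneg_of_le (fun k ↦ norm_nonneg _) fun k ↦ ?_
      rw [Real.norm_eq_abs, abs_mul]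
      exact mul_le_of_le_one_right (abs_nonneg _) (abs_one_sub_pow_le hx' k)
    rw [frobSol, sq, tsum_mul_tsum_of_summable_norm hsx hsx]
    refine tsum_congr fun p ↦ ?_
    rw [pow_add]; ring
  rw [intervalIntegral.integral_of_le zero_le_one,
    setIntegral_congr_fun measurableSet_Ioc hpt]
  have hG_int : ∀ p : ℕ × ℕ, Integrable (fun x : ℝ ↦ a p.1 * a p.2 * (1 - x) ^ (p.1 + p.2))
      (volume.restrict (Ioc 0 1)) :=
    fun p ↦ (Continuous.integrableOn_Icc (by fun_prop)).mono_set Ioc_subset_Icc_self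
  have hnorm : ∀ p : ℕ × ℕ, ∫ x in Ioc (0 : ℝ) 1, ‖a p.1 * a p.2 * (1 - x) ^ (p.1 + p.2)‖ =
      |a p.1| * |a p.2| / ((p.1 : ℝ) + p.2 + 1) := by
    intro p
    rw [← intervalIntegral.integral_of_le zero_le_one]
    have : ∀ x ∈ uIcc (0 : ℝ) 1, ‖a p.1 * a p.2 * (1 - x) ^ (p.1 + p.2)‖ =
        |a p.1| * |a p.2| * (1 - x) ^ (p.1 + p.2) := by
      intro x hx
      rw [Real.norm_eq_abs, abs_mul, abs_mul, abs_of_nonneg (one_sub_pow_nonneg hx _)]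
    rw [intervalIntegral.integral_congr this, intervalIntegral.integral_const_mul, integral_one_sub_pow]
    push_cast
    ring
  have hG_sum : Summable fun p : ℕ × ℕ ↦ ∫ x in Ioc (0 : ℝ) 1, ‖a p.1 * a p.2 * (1 - x) ^ (p.1 + p.2)‖ := by
    simp_rw [hnorm]
    have hprod : Summable fun p : ℕ × ℕ ↦ |a p.1| * |a p.2| :=
      summable_mul_of_summable_norm (f := fun k ↦ |a k|) (g := fun k ↦ |a k|)
        (by simpa using hsa) (by simpa using hsa)
    refine hprod.of_nonneg_of_le (fun p ↦ by positivity) fun p ↦ ?_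
    exact div_le_self (by positivity) (by linarith [(by positivity : (0 : ℝ) ≤ (p.1 : ℝ) + p.2)])
  have h := integral_tsum_of_summable_integral_norm hG_int hG_sum
  have hterm : ∀ p : ℕ × ℕ, ∫ x in Ioc (0 : ℝ) 1, a p.1 * a p.2 * (1 - x) ^ (p.1 + p.2) =
      a p.1 * a p.2 / ((p.1 : ℝ) + p.2 + 1) := by
    intro p
    rw [← intervalIntegral.integral_of_le zero_le_one, intervalIntegral.integral_const_mul,
      integral_one_sub_pow]
    push_cast
    ring
  simp_rw [hterm] at h
  rw [← h]

/-- **Tail control for `∫₀¹ u_χ²`**: with `A = Σ_{k<N}|a_k|` and `τ = Σ_k |a_{k+N}|`,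
`|∫₀¹ u_χ² − Σ_{i<N}Σ_{j<N} a_i a_j/(i+j+1)| ≤ 2Aτ + τ²`.
[cite: ConnesConsani2021, Lemma 5.4 §5 p. 33 (the truncated sums behind ε′(1⁺) ≃ 22.9965); CoddingtonLevinson1955, Ch. 4 §8] -/
theorem abs_integral_frobSol_sq_one_sub_le (χ : ℝ) (N : ℕ) :
    |(∫ x in (0 : ℝ)..1, frobSol 1 χ x ^ 2) -
        ∑ i ∈ range N, ∑ j ∈ range N, frobCoeff 1 χ i * frobCoeff 1 χ j / ((i : ℝ) + j + 1)|
      ≤ 2 * (∑ k ∈ range N, |frobCoeff 1 χ k|) * (∑' k : ℕ, |frobCoeff 1 χ (k + N)|) +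
        (∑' k : ℕ, |frobCoeff 1 χ (k + N)|) ^ 2 := by
  set a : ℕ → ℝ := fun k ↦ frobCoeff 1 χ k with ha
  have hsa : Summable fun k ↦ |a k| := summable_abs_frobCoeff_one χ
  set G : ℕ × ℕ → ℝ := fun p ↦ a p.1 * a p.2 / ((p.1 : ℝ) + p.2 + 1) with hG
  set H : ℕ × ℕ → ℝ := fun p ↦ |a p.1| * |a p.2| with hH
  have hHs : Summable H :=
    summable_mul_of_summable_norm (f := fun k ↦ |a k|) (g := fun k ↦ |a k|)
      (by simpa using hsa) (by simpa using hsa)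
  have hGH : ∀ p, |G p| ≤ H p := by
    intro p
    simp only [hG, hH, abs_div, abs_mul]
    rw [abs_of_pos (by positivity : (0 : ℝ) < (p.1 : ℝ) + p.2 + 1)]
    exact div_le_self (by positivity) (by linarith [(by positivity : (0 : ℝ) ≤ (p.1 : ℝ) + p.2)])
  have hGs : Summable G := Summable.of_norm_bounded hHs (fun p ↦ by rw [Real.norm_eq_abs]; exact hGH p)
  set S : Finset (ℕ × ℕ) := range N ×ˢ range N with hS
  rw [integral_frobSol_sq_one]
  change |∑' p, G p - _| ≤ _
  have hfin : ∑ i ∈ range N, ∑ j ∈ range N, frobCoeff 1 χ i * frobCoeff 1 χ j / ((i : ℝ) + j + 1) =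
      ∑ p ∈ S, G p := by
    rw [hS, Finset.sum_product]
  rw [hfin, ← hGs.sum_add_tsum_subtype_compl S, add_sub_cancel_left]
  -- the complement sum of |G| is at most that of H
  have hGc : Summable fun p : {p // p ∉ S} ↦ G p := hGs.subtype _
  have hHc : Summable fun p : {p // p ∉ S} ↦ H p := hHs.subtype _
  have hGca : Summable fun p : {p // p ∉ S} ↦ |G p| :=
    hHc.of_nonneg_of_le (fun p ↦ abs_nonneg _) fun p ↦ hGH p
  have h1 : |∑' p : {p // p ∉ S}, G p| ≤ ∑' p : {p // p ∉ S}, H p :=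
    (abs_tsum_le_tsum_abs hGca).trans (Summable.tsum_le_tsum (fun p ↦ hGH p) hGca hHc)
  refine h1.trans ?_
  -- Σ_{Sᶜ} H = (Σ|a|)² − A²
  have hsplit := hHs.sum_add_tsum_subtype_compl S
  have htot : ∑' p, H p = (∑' k, |a k|) ^ 2 := by
    rw [sq, tsum_mul_tsum_of_summable_norm (by simpa using hsa) (by simpa using hsa)]
  have hsq : ∑ p ∈ S, H p = (∑ k ∈ range N, |a k|) ^ 2 := by
    rw [hS, Finset.sum_product, sq, Finset.sum_mul_sum]
  have htail := tsum_abs_frobCoeff_split χ N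
  have hA : 0 ≤ ∑ k ∈ range N, |a k| := Finset.sum_nonneg fun k _ ↦ abs_nonneg _
  have hτ : 0 ≤ ∑' k : ℕ, |frobCoeff 1 χ (k + N)| := tsum_nonneg fun k ↦ abs_nonneg _
  have : ∑' p : {p // p ∉ S}, H p = (∑' k, |a k|) ^ 2 - (∑ k ∈ range N, |a k|) ^ 2 := by
    linarith [hsplit, htot, hsq]
  rw [this, htail]
  simp only [ha]
  nlinarith [hA, hτ]

end Literature.NumberTheory.ConnesConsani2021.SlopeCert
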